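import Summits.QuantumFields.YangMills.Theorems.BalabanUVNodesN11FirstStepFailsAtEveryWitness

/-!
# DAG node N11 — ★ `¬ TLaw₁₃ θ p 0` AT EVERY STAGE-13 WITNESS, WITH NO HYPOTHESIS ON THE (2.12) REGULARITY THRESHOLD `εreg` AND NO BRANCH OF def-R's
# `UminOfRecord`: the typed first instance of K1⁗'s N11 conjunct (S1ᵀ)₁₃ is unsatisfiable as stated (the assembly of `…FirstStepFailsAtEveryWitness`)

Cell `pub-ymgap`, YM-PLAN Track A (HUMAN RULING D-0062), seat `pub-ymgap-dag-n11-d` (g6; R134 fan-out seat N11 [B14], strategy s2), item K1⁗ `StabilityBAtRecordR13Sep`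
= stmt-QuantumFields-20290.  [III] = [Balaban1988Convergent], [B7] = [Balaban1985Averaging].  This file is the assembly step of this seat's
`…N11FirstStepFailsAtEveryWitness` (§1 the §2-form slot of ANY new sequence dies on the central-rough coarse fields of a cube in `Ω₁ᶜ`; §2 the `(∅,∅)`-labelled pre-𝐑
slots die on rough coarse fields; §3 positivity of the central-rough event) with K0b's level-1 unity identity `𝐓ρ₀ = T[ρ₀]` (`Record12ResidualsSlots`).

WHAT THIS FILE PROVES (0 `sorry`, 0 `def`, standard axioms; `N`-generic).
* ★★★ **`not_hasSect2FormTAEZ_zero`** (BACKGROUND-GENERIC: the 𝐓-image §2-form predicate of the pre-𝐑 slot family at index `0` is false for EVERY background map —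
  the proof never reads it; `TLaw₁₃` and the Co re-base `TLaw₁₃Co` are instances) and ★★★ **`not_tLaw₁₃_zero`** — AT EVERY `θ : Stage13Params F N` whose step-weight residual `ζ` resolves unity with `Σ|ζ| ≤ 1` and has measurable `U`-sections
  (DISPLAYED; discharged in `…_of_hasResidualsOfRecord`), on every run `p` with `0 < K`, `1 ≤ M`, `1 ≤ M₂`, χ₁-cube side `2((d+5)L + 3) ≤ sideχ` (true once `R₁ = L^s`
  is large, i.e. `g₁` small), the two SMALL parameters guarded as [B7] needs them — `a := cR·ε₀(g₀)` with `0 < a`, `(((d+4)L)²/4)·a ≤ δ_N/2` (Prop. 1) and `β` with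
  `ε₁η₁² + 8δ₀ ≤ βη₁²`, `0 < β`, `C₀(d)β ≤ ⅓`, `2β ≤ 2δ_N/((d+4)L)²` (Prop. 2) — and `SU(N)` non-trivial at the two thresholds (`∃ g, L²a + C₀(d)(L²a)² < dist1 g ∧
  2β < dist1 g`): **`¬ TLaw₁₃ F N θ p 0`**.  The regularity threshold `θ.ν.εreg` of the (2.12) class does NOT occur.
  PROOF.  Let `T` be the larger threshold.  Under `TLaw₁₃ θ p 0` with witness `(t, E₁)`, for `dV₁`-a.e. `V₁` whose central plaquette of EVERY χ₁-cube has
  `dist1 ≥ T`, every summand of `𝐓ρ₀(V₁) = Σ_{s′} χ₁(s′)(V₁)·slotT_1(s′)(V₁)` vanishes: if `χ₁(s′)(V₁) ≠ 0` and the slot is not absent, the law gives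
  `slotT_1(s′)(V₁) = 𝐓_1(s′)e^{A_1(s′)}(V₁)`; when some label `(P,Q,R,S) ↦ s′` has `(P,Q) ≠ (∅,∅)`, a χ₁-cube of `P ∪ Q` lies in `Ω₁(s′)ᶜ` and §1 kills the right side;
  otherwise §2 kills the left side directly.  But the sum IS `T[ρ₀](V₁) = avgDensity(V₁)·∫ρ₀ dκ_{V₁}` (K0b's `trhoOfRecord9_zero_eq_transport`), so `avgDensity = 0` a.e.
  on the central-rough fields, i.e. `dU{Ū central-rough} = 0` — against §3.
* **`not_tLaw₁₃_zero_of_hasResidualsOfRecord`** (K0b's residuals: the three ζ-hypotheses discharged by name), **`not_tLaw₁₃_zero_su2_of_hasResidualsOfRecord`**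
  (`N = 2`: n07-e's `su2_dist1_surj` gives an element at distance `2`; the Prop-2 guard forces `2β < 2`, the other threshold `< 2` is displayed), ★★★
  **`not_s1T₁₃_su2_of_hasResidualsOfRecord`** — the (S1ᵀ)₁₃ conjunct `∀ k < K, SLaw₁₃ θ p k → TLaw₁₃ θ p k` of K1⁗'s rung 1 is FALSE at every such `θ : Stage13Params F 2`
  and run (`SLaw₁₃ θ p 0` is def-T's theorem).
* §2 ★★★ **`not_tLaw₁₃_zero_theta13LiveOfRecord`** ∕ **`not_s1T₁₃_theta13LiveOfRecord_su2`** — THE SAME AT K0a's WITNESS OF RECORD `theta13LiveOfRecord` (`εreg = 1`, OUTSIDE every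
  [B7] range; `cR = 1`, `M = M₂ = 1`, K0b's residuals): hypotheses = `0 < K`, the cube-size condition, the Prop-1 guard on `ε₀(g₀)`, the Prop-2 guards on `β`, and
  (general `N`) non-triviality of `SU(N)` at the two thresholds ∕ (`N = 2`) the first threshold `< 2`.

READING (count-neutral; nothing of Bałaban asserted or refuted).  This closes the kernel half of the desk's Q-W without the proviso this seat's g5 files carried
(`εreg` in [B7] Prop. 2's range, used only to decide def-R's (2.12) branch at rough data): the verdict «typed-statement defect at the 12a∕def-T junction» (lit-balaban
ME #15; ref-H PLACEMENT-20) holds at EVERY witness of the current record — in particular at the witness of record `theta13LiveOfRecord` (`εreg = 1`; instance in the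
sequel file).  The cure is the re-type of the 𝐓-image∕§2-slot junction (12a∕def-T), not a choice of `θ`.  K1⁗ (an `∃ θ` statement) is NOT thereby refuted; N11 ∕ K1⁗
NOT discharged; counts unmoved (typed 28∕28 · discharged 5∕28).  One finite four-torus at fixed `ε = L^{−K}`; NOT ℝ⁴ ∕ OS ∕ mass gap ∕ Clay.  Sources: [III] Theorem
p.245, Thm 1 p.262, (2.10) p.256, (2.17)–(2.18) p.257, (2.21) p.258, (3.1)–(3.5) pp.264–265, (3.16) p.268, (3.24)–(3.25) p.270; [B7] (10) p.19, Prop. 1 (51) pp.25–26,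
Prop. 2 (52)–(54) p.26.
-/

noncomputable section

open MeasureTheory ProbabilityTheory
open scoped BigOperators Matrix.Norms.L2Operator ENNReal NNReal

namespace Summit.QuantumFields.YangMills.Theorems.BalabanUVNodesN11NoTLawAtAnyRegularity

open Literature.MathematicalPhysics.QuantumFieldTheory.Balaban1983to89 T4Continuum Node00 Node00.Tk DagBinding
open Literature.MathematicalPhysics.QuantumFieldTheory.Balaban1983to89.T4AveragingDisintegration (avgDensity)
open Literature.MathematicalPhysics.QuantumFieldTheory.Balaban1983to89.ExpMeanLog (deltaSU)
open B15Claim189CubePin (cubeOfSite cubeOfSite_mem_cubeIndices)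
open GaugeField (plaqHol)
open B15Eq112TorusCover (cover)
open Summit.QuantumFields.YangMills.Theorems.BalabanUVNodesN11AllLargeFieldLabel
  (sideD_pos sideχ_pos transportOfRecord_rhoZero_eq_zero_iff fieldMeasure_preimage_eq_zero_of_avgDensity_ae_zero)
open Summit.QuantumFields.YangMills.BalabanUVNodes.N07Thm1ScaledInterfaceInstance (su2_dist1_surj)
open Summit.QuantumFields.YangMills.Theorems.BalabanUVNodesN11FirstStepFailsAtEveryWitness

variable {F : T4Family} {N : ℕ} [NeZero N]

/-! ## §1. `¬ TLaw₁₃ θ p 0` at every Stage-13 witness -/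

section Negation

variable (θ : Stage13Params F N) (p : B12.RunParams)

/-- ★★★ **THE FIRST 𝐓-STEP §2-FORM LAW OF RECORD FAILS AT EVERY STAGE-13 WITNESS, FOR EVERY BACKGROUND MAP — no hypothesis on the (2.12) threshold `εreg`, no
branch of `UminOfRecord`** (ζ-unity, `Σ|ζ| ≤ 1`, measurable `U`-sections of the step weights; `0 < K`, `1 ≤ M`, `1 ≤ M₂`, cube side `2((d+5)L+3) ≤ sideχ`; [B7] Prop. 1
guard on `a = cR·ε₀ > 0`, Prop. 2 guards on `β` with `ε₁η₁² + 8δ₀ ≤ βη₁²`; `SU(N)` non-trivial at both thresholds): the 𝐓-image §2-form predicate `HasSect2FormTAEZ … 0 Ubg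
slotT_1` of the pre-𝐑 slot family of record is FALSE whatever the background map `Ubg` (the proof never reads it — `TLaw₁₃`, `TLaw₁₃Co` are the instances).
[cite: Balaban1988Convergent, Theorem p.245, (3.25) p.270, (3.1)–(3.5) pp.264–265, (2.10) p.256, (2.21) p.258; Balaban1985Averaging, Prop. 1 (51) pp.25–26, Prop. 2 (52)–(54) p.26, (10) p.19] -/
theorem not_hasSect2FormTAEZ_zero (Ubg : SeqOfRecord F θ.ν θ.τ9.M (gOfRecord₁₃ F N θ p) p.K 1 → BgMap F N p.K)
    (hζ : IsZetaUnity F N θ.ν θ.τ9.M θ.ζ) (hζ' : IsZetaAbsLeOne F N θ.ν θ.τ9.M θ.ζ)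
    (hw : ∀ (s' : SeqOfRecord F θ.ν θ.τ9.M (gOfRecord₁₃ F N θ p) p.K 1) (V' : GaugeField (F.P p.K) 1 (SU N)),
      Measurable (fun U : GaugeField (F.P p.K) 0 (SU N) => wOfRecord F N θ.ν θ.τ9.M θ.A₁ θ.ζ p (gOfRecord₁₃ F N θ p) 0 s' U V'))
    (hK : 0 < p.K) (hMτ : 1 ≤ θ.τ9.M) (hM₂ : 1 ≤ θ.ν.M₂)
    (hS : 2 * ((((F.P p.K).d + 4) * (F.P p.K).L + 2) + (F.P p.K).L + 1) ≤ sideχ F θ.ν p (gOfRecord₁₃ F N θ p) 0)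
    (ha : 0 < θ.s2.cR * epsOfRecord θ.ν (gOfRecord₁₃ F N θ p) 0)
    (has : ((((F.P p.K).d + 4) * (F.P p.K).L : ℕ) : ℝ) ^ 2 / 4 * (θ.s2.cR * epsOfRecord θ.ν (gOfRecord₁₃ F N θ p) 0) ≤ deltaSU (Fin N) / 2)
    {β : ℝ} (hβ : 0 < β) (hβ3 : (143 * (((((F.P p.K).d + 4 : ℕ) : ℝ)) ^ 2 / 4) ^ 2) * β ≤ 1 / 3)
    (hβ2 : 2 * β ≤ 2 * deltaSU (Fin N) / ((((F.P p.K).d + 4) * (F.P p.K).L : ℕ) : ℝ) ^ 2)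
    (hβε : epsOfRecord θ.ν (gOfRecord₁₃ F N θ p) 1 * (F.P p.K).eta 1 ^ 2 + 4 * (2 * deltaOfRecord θ.ν (gOfRecord₁₃ F N θ p) 0 θ.A₁) ≤
      β * (F.P p.K).eta 1 ^ 2)
    (hg : ∃ g₀ : SU N,
      ((F.P p.K).L : ℝ) ^ 2 * (θ.s2.cR * epsOfRecord θ.ν (gOfRecord₁₃ F N θ p) 0) +
          143 * (((((F.P p.K).d + 4) * (F.P p.K).L : ℕ) : ℝ) ^ 2 / 4 * (θ.s2.cR * epsOfRecord θ.ν (gOfRecord₁₃ F N θ p) 0)) ^ 2 < dist1 g₀ ∧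
        2 * β < dist1 g₀) :
    ¬ HasSect2FormTAEZ F N (FluctV N) p.K (settingOfRecord₁₃ F N θ p) (θ.Rz p.K) (WtOfRecord₁₃ F N θ p) 0 Ubg
      (slotsTOfRecord F N θ.ν θ.τ9 (EOfRecord₁₃ F N θ) (wOfRecord₉ F N θ.toStage9Params) θ.ppSel p (gOfRecord₁₃ F N θ p) 1) := by
  classical
  intro hT
  -- the two thresholds and their maximum
  set T₁ : ℝ := ((F.P p.K).L : ℝ) ^ 2 * (θ.s2.cR * epsOfRecord θ.ν (gOfRecord₁₃ F N θ p) 0) +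
      143 * (((((F.P p.K).d + 4) * (F.P p.K).L : ℕ) : ℝ) ^ 2 / 4 * (θ.s2.cR * epsOfRecord θ.ν (gOfRecord₁₃ F N θ p) 0)) ^ 2 with hT₁
  set T : ℝ := max T₁ (2 * β) with hTdef
  obtain ⟨g₀, hg₁, hg₂⟩ := hg
  have hTlt : T < dist1 g₀ := max_lt hg₁ hg₂
  have hD := sideD_pos (F := F) θ.ν hMτ p (gOfRecord₁₃ F N θ p) 0
  have hχ := sideχ_pos (F := F) hM₂ p (gOfRecord₁₃ F N θ p) 0
  -- the witness of the law
  obtain ⟨t, Ek, -, hs⟩ := hT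
  -- (A) §1: the §2-form slot of every `s′` dies on the central-rough fields of every cube in `Ω₁(s′)ᶜ`
  have hA : ∀ᵐ V1 ∂fieldMeasure (F.P p.K) 1 (SU N), ∀ (s : SeqOfRecord F θ.ν θ.τ9.M (gOfRecord₁₃ F N θ p) p.K 1) (c : Iχ F θ.ν p (gOfRecord₁₃ F N θ p) 0)
      (q : Plaq (F.P p.K) 1), cubeχ F θ.ν p (gOfRecord₁₃ F N θ p) 0 c ⊆ (s.Ω 1)ᶜ →
      q.src = blockOf (cover (F.P p.K) (fun i => ((sideχ F θ.ν p (gOfRecord₁₃ F N θ p) 0 : ℕ) : ℤ) * (c : B14DomainGeom.Pt (F.P p.K).d) i + ((sideχ F θ.ν p (gOfRecord₁₃ F N θ p) 0 / 2 : ℕ) : ℤ))) →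
      T ≤ dist1 (plaqHol V1 q) →
        sect2Slot F N (FluctV N) p.K (settingOfRecord₁₃ F N θ p) (θ.Rz p.K) (WtOfRecord₁₃ F N θ p) s (t s) (Ek s)
          (Ubg s) V1 = 0 := by
    refine ae_all_iff.2 fun s => ae_all_iff.2 fun c => ae_all_iff.2 fun q => ?_
    by_cases hc : cubeχ F θ.ν p (gOfRecord₁₃ F N θ p) 0 c ⊆ (s.Ω 1)ᶜ
    · by_cases hq : q.src = blockOf (cover (F.P p.K) (fun i => ((sideχ F θ.ν p (gOfRecord₁₃ F N θ p) 0 : ℕ) : ℤ) * (c : B14DomainGeom.Pt (F.P p.K).d) i + ((sideχ F θ.ν p (gOfRecord₁₃ F N θ p) 0 / 2 : ℕ) : ℤ)))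
      · filter_upwards [sect2Slot_one_ae_zero_on_centralRough₁₃ θ p (T := T) ha has (hT₁ ▸ le_max_left _ _) hS s hc hq (t s) (Ek s)
          (Ubg s)] with V1 hV1 _ _ hr
        exact hV1 hr
      · exact Filter.Eventually.of_forall fun V1 _ hq' => absurd hq' hq
    · exact Filter.Eventually.of_forall fun V1 hc' => absurd hc' hc
  -- (B) §2: the sequences reached only by `(∅,∅)`-labels die on the rough fields
  have hB := slotsT_one_ae_zero_of_emptyLabels₁₃ θ p hχ hβ hβ3 hβ2 hβε
  -- (C) the identity clauses of the law, all sequences at once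
  have hC : ∀ᵐ V1 ∂fieldMeasure (F.P p.K) 1 (SU N), ∀ s : SeqOfRecord F θ.ν θ.τ9.M (gOfRecord₁₃ F N θ p) p.K 1,
      slotsTOfRecord F N θ.ν θ.τ9 (EOfRecord₁₃ F N θ) (wOfRecord₉ F N θ.toStage9Params) θ.ppSel p (gOfRecord₁₃ F N θ p) 1 s = 0 ∨ (chiSeqOfRecord F N θ.ν θ.τ9.M (gOfRecord₁₃ F N θ p) p.K 1 s V1 ≠ 0 → slotsTOfRecord F N θ.ν θ.τ9 (EOfRecord₁₃ F N θ) (wOfRecord₉ F N θ.toStage9Params) θ.ppSel p (gOfRecord₁₃ F N θ p) 1 s V1 =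
        sect2Slot F N (FluctV N) p.K (settingOfRecord₁₃ F N θ p) (θ.Rz p.K) (WtOfRecord₁₃ F N θ p) s (t s) (Ek s)
          (Ubg s) V1) := by
    refine ae_all_iff.2 fun s => ?_
    rcases (hs s).2 with h0 | hid
    · exact Filter.Eventually.of_forall fun V1 => Or.inl h0
    · filter_upwards [hid] with V1 hV1
      exact Or.inr hV1
  -- a cube (the family is nonempty)
  set c₀ : Iχ F θ.ν p (gOfRecord₁₃ F N θ p) 0 := ⟨cubeOfSite (sideχ F θ.ν p (gOfRecord₁₃ F N θ p) 0) (fun _ => 0), cubeOfSite_mem_cubeIndices _ hχ _⟩ with hc₀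
  -- hence `avgDensity = 0` a.e. on the central-rough coarse fields
  have hae : ∀ᵐ V1 ∂fieldMeasure (F.P p.K) 1 (SU N), (∀ c : Iχ F θ.ν p (gOfRecord₁₃ F N θ p) 0, ∃ q : Plaq (F.P p.K) 1,
      q.src = blockOf (cover (F.P p.K) (fun i => ((sideχ F θ.ν p (gOfRecord₁₃ F N θ p) 0 : ℕ) : ℤ) * (c : B14DomainGeom.Pt (F.P p.K).d) i + ((sideχ F θ.ν p (gOfRecord₁₃ F N θ p) 0 / 2 : ℕ) : ℤ))) ∧
        T ≤ dist1 (plaqHol V1 q)) → True → (avgDensity (avOfRecord F N p.K 0).avg V1 : ℝ) = 0 := by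
    filter_upwards [hA, hB, hC] with V1 hAV hBV hCV hrough _
    -- every summand of the 𝐓-image density vanishes at `V₁`
    have hzero : ∀ s : SeqOfRecord F θ.ν θ.τ9.M (gOfRecord₁₃ F N θ p) p.K 1, chiSeqOfRecord F N θ.ν θ.τ9.M (gOfRecord₁₃ F N θ p) p.K 1 s V1 * slotsTOfRecord F N θ.ν θ.τ9 (EOfRecord₁₃ F N θ) (wOfRecord₉ F N θ.toStage9Params) θ.ppSel p (gOfRecord₁₃ F N θ p) 1 s V1 = 0 := by
      intro s
      by_cases hχ0 : chiSeqOfRecord F N θ.ν θ.τ9.M (gOfRecord₁₃ F N θ p) p.K 1 s V1 = 0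
      · rw [hχ0, zero_mul]
      rcases hCV s with h0 | hid
      · rw [h0, Pi.zero_apply, mul_zero]
      by_cases hlab : ∀ tt : LbOfRecord F θ.ν p (gOfRecord₁₃ F N θ p) 0, σOfRecord F θ.ν θ.τ9.M p (gOfRecord₁₃ F N θ p) 0 s.init tt = s → tt.1 = ∅ ∧ tt.2.1 = ∅
      · obtain ⟨q₀, -, hq₀⟩ := hrough c₀
        rw [hBV s q₀ hlab ((le_max_right _ _).trans hq₀), mul_zero]
      · push Not at hlab
        obtain ⟨tt, htt, hne⟩ := hlab
        have hne' : tt.1 ≠ ∅ ∨ tt.2.1 ≠ ∅ := by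
          by_cases h1 : tt.1 = ∅
          · exact Or.inr (hne h1).ne_empty
          · exact Or.inl h1
        obtain ⟨c, hc⟩ := exists_cubeχ_subset_compl_OmegaOfLabel F θ.ν θ.τ9.M p (gOfRecord₁₃ F N θ p) 0 hD s.init tt hne'
        have hΩeq : (σOfRecord F θ.ν θ.τ9.M p (gOfRecord₁₃ F N θ p) 0 s.init tt).Ω (0 + 1) = OmegaOfLabel F θ.ν θ.τ9.M p (gOfRecord₁₃ F N θ p) 0 s.init tt :=
          σOfRecord_Ω_succ F θ.ν θ.τ9.M p (gOfRecord₁₃ F N θ p) 0 s.init tt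
        rw [htt] at hΩeq
        have hc' : cubeχ F θ.ν p (gOfRecord₁₃ F N θ p) 0 c ⊆ (s.Ω 1)ᶜ := by
          rw [show s.Ω 1 = s.Ω (0 + 1) from rfl, hΩeq]; exact hc
        obtain ⟨q, hq, hqr⟩ := hrough c
        rw [hid hχ0, hAV s c q hc' hq hqr, mul_zero]
    -- the sum of the summands is the 𝐓-image density, which IS the transport of `ρ₀` (K0b)
    have hsum : tdensOfRecord₁₃ F N θ p 0 V1 = ∑ s : SeqOfRecord F θ.ν θ.τ9.M (gOfRecord₁₃ F N θ p) p.K 1, chiSeqOfRecord F N θ.ν θ.τ9.M (gOfRecord₁₃ F N θ p) p.K 1 s V1 * slotsTOfRecord F N θ.ν θ.τ9 (EOfRecord₁₃ F N θ) (wOfRecord₉ F N θ.toStage9Params) θ.ppSel p (gOfRecord₁₃ F N θ p) 1 s V1 := rfl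
    have htr : tdensOfRecord₁₃ F N θ p 0 V1 =
        transportOfRecord F N p.K 0 (rhoZeroOfRecord F N p.K ((gOfRecord₁₃ F N θ p) 0) (EOfRecord₁₃ F N θ p)) V1 :=
      trhoOfRecord9_zero_eq_transport F N θ.ν θ.τ9 θ.A₁ hζ hζ' (EOfRecord₁₃ F N θ) θ.ppSel p (gOfRecord₁₃ F N θ p) hw V1
    have h0 : transportOfRecord F N p.K 0 (rhoZeroOfRecord F N p.K ((gOfRecord₁₃ F N θ p) 0) (EOfRecord₁₃ F N θ p)) V1 = 0 := by
      rw [← htr, hsum]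
      exact Finset.sum_eq_zero fun s _ => hzero s
    exact (transportOfRecord_rhoZero_eq_zero_iff p.K _ _ V1).1 h0
  -- … so the central-rough coarse fields have a preimage of Haar measure zero — against §3 of the previous file
  have hzero := fieldMeasure_preimage_eq_zero_of_avgDensity_ae_zero p hK hae
    (measurableSet_centralRough F N θ.ν p (gOfRecord₁₃ F N θ p) T) (fun V1 hV1 => hV1) (fun _ _ => trivial)
  exact (fieldMeasure_preimage_centralRough_pos F N θ.ν p (gOfRecord₁₃ F N θ p) g₀ hTlt).ne' hzero

/-- ★★★ **`¬ TLaw₁₃ θ p 0` AT EVERY STAGE-13 WITNESS** (def-R's multi-scale background `UbgOfRecord₁₃`; hypotheses as in `not_hasSect2FormTAEZ_zero`).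
[cite: Balaban1988Convergent, Theorem p.245, (3.25) p.270; Balaban1985Averaging, Prop. 1 (51) pp.25–26, Prop. 2 (52)–(54) p.26] -/
theorem not_tLaw₁₃_zero (hζ : IsZetaUnity F N θ.ν θ.τ9.M θ.ζ) (hζ' : IsZetaAbsLeOne F N θ.ν θ.τ9.M θ.ζ)
    (hw : ∀ (s' : SeqOfRecord F θ.ν θ.τ9.M (gOfRecord₁₃ F N θ p) p.K 1) (V' : GaugeField (F.P p.K) 1 (SU N)),
      Measurable (fun U : GaugeField (F.P p.K) 0 (SU N) => wOfRecord F N θ.ν θ.τ9.M θ.A₁ θ.ζ p (gOfRecord₁₃ F N θ p) 0 s' U V'))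
    (hK : 0 < p.K) (hMτ : 1 ≤ θ.τ9.M) (hM₂ : 1 ≤ θ.ν.M₂)
    (hS : 2 * ((((F.P p.K).d + 4) * (F.P p.K).L + 2) + (F.P p.K).L + 1) ≤ sideχ F θ.ν p (gOfRecord₁₃ F N θ p) 0)
    (ha : 0 < θ.s2.cR * epsOfRecord θ.ν (gOfRecord₁₃ F N θ p) 0)
    (has : ((((F.P p.K).d + 4) * (F.P p.K).L : ℕ) : ℝ) ^ 2 / 4 * (θ.s2.cR * epsOfRecord θ.ν (gOfRecord₁₃ F N θ p) 0) ≤ deltaSU (Fin N) / 2)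
    {β : ℝ} (hβ : 0 < β) (hβ3 : (143 * (((((F.P p.K).d + 4 : ℕ) : ℝ)) ^ 2 / 4) ^ 2) * β ≤ 1 / 3)
    (hβ2 : 2 * β ≤ 2 * deltaSU (Fin N) / ((((F.P p.K).d + 4) * (F.P p.K).L : ℕ) : ℝ) ^ 2)
    (hβε : epsOfRecord θ.ν (gOfRecord₁₃ F N θ p) 1 * (F.P p.K).eta 1 ^ 2 + 4 * (2 * deltaOfRecord θ.ν (gOfRecord₁₃ F N θ p) 0 θ.A₁) ≤
      β * (F.P p.K).eta 1 ^ 2)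
    (hg : ∃ g₀ : SU N,
      ((F.P p.K).L : ℝ) ^ 2 * (θ.s2.cR * epsOfRecord θ.ν (gOfRecord₁₃ F N θ p) 0) +
          143 * (((((F.P p.K).d + 4) * (F.P p.K).L : ℕ) : ℝ) ^ 2 / 4 * (θ.s2.cR * epsOfRecord θ.ν (gOfRecord₁₃ F N θ p) 0)) ^ 2 < dist1 g₀ ∧
        2 * β < dist1 g₀) :
    ¬ TLaw₁₃ F N θ p 0 := fun hT =>
  not_hasSect2FormTAEZ_zero θ p _ hζ hζ' hw hK hMτ hM₂ hS ha has hβ hβ3 hβ2 hβε hg ((tLaw₁₃_iff F N θ p 0).mp hT)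

/-- **THE SAME FOR A WITNESS CARRYING K0b's RESIDUALS OF RECORD** (`θ.HasResidualsOfRecord`: ζ-unity, `Σ|ζ| ≤ 1` and the measurability of the `U`-sections of the step
weights are K0b's theorems at `ζ = zeta316OfRecord`). [cite: Balaban1988Convergent, Theorem p.245, (3.25) p.270, (3.16) p.268; Balaban1985Averaging, Prop. 1 (51) pp.25–26, Prop. 2 (52)–(54) p.26] -/
theorem not_tLaw₁₃_zero_of_hasResidualsOfRecord (hres : θ.HasResidualsOfRecord F N) (hK : 0 < p.K) (hMτ : 1 ≤ θ.τ9.M) (hM₂ : 1 ≤ θ.ν.M₂)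
    (hS : 2 * ((((F.P p.K).d + 4) * (F.P p.K).L + 2) + (F.P p.K).L + 1) ≤ sideχ F θ.ν p (gOfRecord₁₃ F N θ p) 0)
    (ha : 0 < θ.s2.cR * epsOfRecord θ.ν (gOfRecord₁₃ F N θ p) 0)
    (has : ((((F.P p.K).d + 4) * (F.P p.K).L : ℕ) : ℝ) ^ 2 / 4 * (θ.s2.cR * epsOfRecord θ.ν (gOfRecord₁₃ F N θ p) 0) ≤ deltaSU (Fin N) / 2)
    {β : ℝ} (hβ : 0 < β) (hβ3 : (143 * (((((F.P p.K).d + 4 : ℕ) : ℝ)) ^ 2 / 4) ^ 2) * β ≤ 1 / 3)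
    (hβ2 : 2 * β ≤ 2 * deltaSU (Fin N) / ((((F.P p.K).d + 4) * (F.P p.K).L : ℕ) : ℝ) ^ 2)
    (hβε : epsOfRecord θ.ν (gOfRecord₁₃ F N θ p) 1 * (F.P p.K).eta 1 ^ 2 + 4 * (2 * deltaOfRecord θ.ν (gOfRecord₁₃ F N θ p) 0 θ.A₁) ≤
      β * (F.P p.K).eta 1 ^ 2)
    (hg : ∃ g₀ : SU N,
      ((F.P p.K).L : ℝ) ^ 2 * (θ.s2.cR * epsOfRecord θ.ν (gOfRecord₁₃ F N θ p) 0) +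
          143 * (((((F.P p.K).d + 4) * (F.P p.K).L : ℕ) : ℝ) ^ 2 / 4 * (θ.s2.cR * epsOfRecord θ.ν (gOfRecord₁₃ F N θ p) 0)) ^ 2 < dist1 g₀ ∧
        2 * β < dist1 g₀) :
    ¬ TLaw₁₃ F N θ p 0 := by
  refine not_tLaw₁₃_zero θ p hres.zetaUnity hres.zetaAbs (fun s' V' => ?_) hK hMτ hM₂ hS ha has hβ hβ3 hβ2 hβε hg
  rw [hres.zeta_eq]
  exact measurable_wOfRecord_zeta316_section θ.A₁ s' V'

/-- **AT THE GROUP OF RECORD `SU(2)`** (n07-e's `su2_dist1_surj`: an element at distance `2`): the two guards force both thresholds below `2` at `d = 4`, so for a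
`θ : Stage13Params F 2` carrying K0b's residuals **`¬ TLaw₁₃ F 2 θ p 0`** on every run with `0 < K` meeting the cube-size and the two small-parameter conditions.
[cite: Balaban1988Convergent, Theorem p.245, (3.25) p.270; Balaban1985Averaging, Prop. 1 (51) pp.25–26, Prop. 2 (52)–(54) p.26; Balaban1987RG1, (0.4) p.253] -/
theorem not_tLaw₁₃_zero_su2_of_hasResidualsOfRecord {F : T4Family} (θ : Stage13Params F 2) (p : B12.RunParams)
    (hres : θ.HasResidualsOfRecord F 2) (hK : 0 < p.K) (hMτ : 1 ≤ θ.τ9.M) (hM₂ : 1 ≤ θ.ν.M₂)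
    (hS : 2 * ((((F.P p.K).d + 4) * (F.P p.K).L + 2) + (F.P p.K).L + 1) ≤ sideχ F θ.ν p (gOfRecord₁₃ F 2 θ p) 0)
    (ha : 0 < θ.s2.cR * epsOfRecord θ.ν (gOfRecord₁₃ F 2 θ p) 0)
    (has : ((((F.P p.K).d + 4) * (F.P p.K).L : ℕ) : ℝ) ^ 2 / 4 * (θ.s2.cR * epsOfRecord θ.ν (gOfRecord₁₃ F 2 θ p) 0) ≤ deltaSU (Fin 2) / 2)
    (ha2 : ((F.P p.K).L : ℝ) ^ 2 * (θ.s2.cR * epsOfRecord θ.ν (gOfRecord₁₃ F 2 θ p) 0) +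
      143 * (((((F.P p.K).d + 4) * (F.P p.K).L : ℕ) : ℝ) ^ 2 / 4 * (θ.s2.cR * epsOfRecord θ.ν (gOfRecord₁₃ F 2 θ p) 0)) ^ 2 < 2)
    {β : ℝ} (hβ : 0 < β) (hβ3 : (143 * (((((F.P p.K).d + 4 : ℕ) : ℝ)) ^ 2 / 4) ^ 2) * β ≤ 1 / 3)
    (hβ2 : 2 * β ≤ 2 * deltaSU (Fin 2) / ((((F.P p.K).d + 4) * (F.P p.K).L : ℕ) : ℝ) ^ 2)
    (hβε : epsOfRecord θ.ν (gOfRecord₁₃ F 2 θ p) 1 * (F.P p.K).eta 1 ^ 2 + 4 * (2 * deltaOfRecord θ.ν (gOfRecord₁₃ F 2 θ p) 0 θ.A₁) ≤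
      β * (F.P p.K).eta 1 ^ 2) :
    ¬ TLaw₁₃ F 2 θ p 0 := by
  obtain ⟨g₀, hg₀⟩ := su2_dist1_surj 2 zero_le_two le_rfl
  have hd : (F.P p.K).d = 4 := rfl
  -- the Prop-2 guard forces `2β < 2`
  have hβlt : 2 * β < 2 := by
    rw [hd] at hβ3
    norm_num at hβ3
    linarith
  exact not_tLaw₁₃_zero_of_hasResidualsOfRecord θ p hres hK hMτ hM₂ hS ha has hβ hβ3 hβ2 hβε
    ⟨g₀, by rw [hg₀]; exact ha2, by rw [hg₀]; exact hβlt⟩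

/-- ★★★ **HENCE THE (S1ᵀ)₁₃ SLOT ITSELF FAILS AT EVERY SUCH WITNESS**: for a `θ : Stage13Params F 2` with K0b's residuals, on every run with `0 < K` meeting the cube-size
and the two small-parameter conditions, the N11 conjunct `∀ k < K, SLaw₁₃ θ p k → TLaw₁₃ θ p k` of K1⁗'s rung 1 is FALSE — `SLaw₁₃ θ p 0` is def-T's theorem
`sLaw₁₃_zero`, and `TLaw₁₃ θ p 0` fails — WHATEVER `θ.ν.εreg`. [cite: Balaban1988Convergent, Theorem p.245, Thm 1 p.262, (3.25) p.270; Balaban1985Averaging, Prop. 1 (51) pp.25–26, Prop. 2 (52)–(54) p.26] -/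
theorem not_s1T₁₃_su2_of_hasResidualsOfRecord {F : T4Family} (θ : Stage13Params F 2) (p : B12.RunParams)
    (hres : θ.HasResidualsOfRecord F 2) (hK : 0 < p.K) (hMτ : 1 ≤ θ.τ9.M) (hM₂ : 1 ≤ θ.ν.M₂)
    (hS : 2 * ((((F.P p.K).d + 4) * (F.P p.K).L + 2) + (F.P p.K).L + 1) ≤ sideχ F θ.ν p (gOfRecord₁₃ F 2 θ p) 0)
    (ha : 0 < θ.s2.cR * epsOfRecord θ.ν (gOfRecord₁₃ F 2 θ p) 0)
    (has : ((((F.P p.K).d + 4) * (F.P p.K).L : ℕ) : ℝ) ^ 2 / 4 * (θ.s2.cR * epsOfRecord θ.ν (gOfRecord₁₃ F 2 θ p) 0) ≤ deltaSU (Fin 2) / 2)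
    (ha2 : ((F.P p.K).L : ℝ) ^ 2 * (θ.s2.cR * epsOfRecord θ.ν (gOfRecord₁₃ F 2 θ p) 0) +
      143 * (((((F.P p.K).d + 4) * (F.P p.K).L : ℕ) : ℝ) ^ 2 / 4 * (θ.s2.cR * epsOfRecord θ.ν (gOfRecord₁₃ F 2 θ p) 0)) ^ 2 < 2)
    {β : ℝ} (hβ : 0 < β) (hβ3 : (143 * (((((F.P p.K).d + 4 : ℕ) : ℝ)) ^ 2 / 4) ^ 2) * β ≤ 1 / 3)
    (hβ2 : 2 * β ≤ 2 * deltaSU (Fin 2) / ((((F.P p.K).d + 4) * (F.P p.K).L : ℕ) : ℝ) ^ 2)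
    (hβε : epsOfRecord θ.ν (gOfRecord₁₃ F 2 θ p) 1 * (F.P p.K).eta 1 ^ 2 + 4 * (2 * deltaOfRecord θ.ν (gOfRecord₁₃ F 2 θ p) 0 θ.A₁) ≤
      β * (F.P p.K).eta 1 ^ 2) :
    ¬ (∀ k, k < p.K → SLaw₁₃ F 2 θ p k → TLaw₁₃ F 2 θ p k) := fun h =>
  not_tLaw₁₃_zero_su2_of_hasResidualsOfRecord θ p hres hK hMτ hM₂ hS ha has ha2 hβ hβ3 hβ2 hβε (h 0 hK (sLaw₁₃_zero F 2 θ p))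

end Negation

/-! ## §2. At K0a's witness of record `theta13LiveOfRecord` (`εreg = 1` — outside every [B7] range; `cR = 1`, `M = M₂ = 1`, K0b's residuals) -/

section AtRecord

variable (F N)

/-- The letter `cR` of the witness of record is `1` (`rfl`). [cite: Balaban1988Convergent, (2.10) p.256 (bookkeeping)] -/
theorem cR_theta13LiveOfRecord : (theta13LiveOfRecord F N).s2.cR = 1 := rfl

/-- ★★★ **AT THE WITNESS OF RECORD `theta13LiveOfRecord` (`εreg = 1`) THE FIRST 𝐓-STEP LAW FAILS** on every run with `0 < K`, χ₁-cube side `2((d+5)L+3) ≤ sideχ`,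
the [B7] Prop. 1 guard on `ε₀(g₀)` (`0 < ε₀`, `(((d+4)L)²/4)·ε₀ ≤ δ_N/2`), the Prop. 2 guards on a `β` with `ε₁η₁² + 8δ₀ ≤ βη₁²`, and `SU(N)` non-trivial at the two
thresholds: **`¬ TLaw₁₃ F N θ_live p 0`** — the located junction defect bites at the record's own inhabitant, where the (2.12) branch at rough data is NOT decided by
the tree (and need not be). [cite: Balaban1988Convergent, Theorem p.245, (3.25) p.270, (2.10) p.256; Balaban1985Averaging, Prop. 1 (51) pp.25–26, Prop. 2 (52)–(54) p.26] -/
theorem not_tLaw₁₃_zero_theta13LiveOfRecord (p : B12.RunParams) (hK : 0 < p.K)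
    (hS : 2 * ((((F.P p.K).d + 4) * (F.P p.K).L + 2) + (F.P p.K).L + 1) ≤
      sideχ F (theta13LiveOfRecord F N).ν p (gOfRecord₁₃ F N (theta13LiveOfRecord F N) p) 0)
    (ha : 0 < epsOfRecord (theta13LiveOfRecord F N).ν (gOfRecord₁₃ F N (theta13LiveOfRecord F N) p) 0)
    (has : ((((F.P p.K).d + 4) * (F.P p.K).L : ℕ) : ℝ) ^ 2 / 4 * epsOfRecord (theta13LiveOfRecord F N).ν (gOfRecord₁₃ F N (theta13LiveOfRecord F N) p) 0 ≤
      deltaSU (Fin N) / 2)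
    {β : ℝ} (hβ : 0 < β) (hβ3 : (143 * (((((F.P p.K).d + 4 : ℕ) : ℝ)) ^ 2 / 4) ^ 2) * β ≤ 1 / 3)
    (hβ2 : 2 * β ≤ 2 * deltaSU (Fin N) / ((((F.P p.K).d + 4) * (F.P p.K).L : ℕ) : ℝ) ^ 2)
    (hβε : epsOfRecord (theta13LiveOfRecord F N).ν (gOfRecord₁₃ F N (theta13LiveOfRecord F N) p) 1 * (F.P p.K).eta 1 ^ 2 +
        4 * (2 * deltaOfRecord (theta13LiveOfRecord F N).ν (gOfRecord₁₃ F N (theta13LiveOfRecord F N) p) 0 (theta13LiveOfRecord F N).A₁) ≤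
      β * (F.P p.K).eta 1 ^ 2)
    (hg : ∃ g₀ : SU N,
      ((F.P p.K).L : ℝ) ^ 2 * epsOfRecord (theta13LiveOfRecord F N).ν (gOfRecord₁₃ F N (theta13LiveOfRecord F N) p) 0 +
          143 * (((((F.P p.K).d + 4) * (F.P p.K).L : ℕ) : ℝ) ^ 2 / 4 *
            epsOfRecord (theta13LiveOfRecord F N).ν (gOfRecord₁₃ F N (theta13LiveOfRecord F N) p) 0) ^ 2 < dist1 g₀ ∧
        2 * β < dist1 g₀) :
    ¬ TLaw₁₃ F N (theta13LiveOfRecord F N) p 0 := by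
  have h1 : (theta13LiveOfRecord F N).s2.cR * epsOfRecord (theta13LiveOfRecord F N).ν (gOfRecord₁₃ F N (theta13LiveOfRecord F N) p) 0 =
      epsOfRecord (theta13LiveOfRecord F N).ν (gOfRecord₁₃ F N (theta13LiveOfRecord F N) p) 0 := by
    rw [cR_theta13LiveOfRecord, one_mul]
  refine not_tLaw₁₃_zero_of_hasResidualsOfRecord _ p (hasResidualsOfRecord_theta13LiveOfRecord F N) hK
    (Summit.QuantumFields.YangMills.Theorems.BalabanUVNodesN11NoExpansionTermFree.one_le_M_theta13LiveOfFamily F N eps0OfRecord₁₃ _ _ (ZtOfRecord F N))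
    le_rfl hS (by rw [h1]; exact ha) (by rw [h1]; exact has) hβ hβ3 hβ2 hβε ?_
  rw [h1]
  exact hg

/-- ★★★ **AT THE GROUP OF RECORD `SU(2)`: the (S1ᵀ)₁₃ conjunct of K1⁗'s rung 1 is FALSE AT THE WITNESS OF RECORD** `theta13LiveOfRecord F 2` on every run with `0 < K`
meeting the cube-size condition and the two small-parameter guards (both thresholds below `2`; an element at distance `2` exists by n07-e's `su2_dist1_surj`).
[cite: Balaban1988Convergent, Theorem p.245, Thm 1 p.262, (3.25) p.270; Balaban1985Averaging, Prop. 1 (51) pp.25–26, Prop. 2 (52)–(54) p.26] -/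
theorem not_s1T₁₃_theta13LiveOfRecord_su2 {F : T4Family} (p : B12.RunParams) (hK : 0 < p.K)
    (hS : 2 * ((((F.P p.K).d + 4) * (F.P p.K).L + 2) + (F.P p.K).L + 1) ≤
      sideχ F (theta13LiveOfRecord F 2).ν p (gOfRecord₁₃ F 2 (theta13LiveOfRecord F 2) p) 0)
    (ha : 0 < epsOfRecord (theta13LiveOfRecord F 2).ν (gOfRecord₁₃ F 2 (theta13LiveOfRecord F 2) p) 0)
    (has : ((((F.P p.K).d + 4) * (F.P p.K).L : ℕ) : ℝ) ^ 2 / 4 * epsOfRecord (theta13LiveOfRecord F 2).ν (gOfRecord₁₃ F 2 (theta13LiveOfRecord F 2) p) 0 ≤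
      deltaSU (Fin 2) / 2)
    (ha2 : ((F.P p.K).L : ℝ) ^ 2 * epsOfRecord (theta13LiveOfRecord F 2).ν (gOfRecord₁₃ F 2 (theta13LiveOfRecord F 2) p) 0 +
        143 * (((((F.P p.K).d + 4) * (F.P p.K).L : ℕ) : ℝ) ^ 2 / 4 *
          epsOfRecord (theta13LiveOfRecord F 2).ν (gOfRecord₁₃ F 2 (theta13LiveOfRecord F 2) p) 0) ^ 2 < 2)
    {β : ℝ} (hβ : 0 < β) (hβ3 : (143 * (((((F.P p.K).d + 4 : ℕ) : ℝ)) ^ 2 / 4) ^ 2) * β ≤ 1 / 3)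
    (hβ2 : 2 * β ≤ 2 * deltaSU (Fin 2) / ((((F.P p.K).d + 4) * (F.P p.K).L : ℕ) : ℝ) ^ 2)
    (hβε : epsOfRecord (theta13LiveOfRecord F 2).ν (gOfRecord₁₃ F 2 (theta13LiveOfRecord F 2) p) 1 * (F.P p.K).eta 1 ^ 2 +
        4 * (2 * deltaOfRecord (theta13LiveOfRecord F 2).ν (gOfRecord₁₃ F 2 (theta13LiveOfRecord F 2) p) 0 (theta13LiveOfRecord F 2).A₁) ≤
      β * (F.P p.K).eta 1 ^ 2) :
    ¬ (∀ k, k < p.K → SLaw₁₃ F 2 (theta13LiveOfRecord F 2) p k → TLaw₁₃ F 2 (theta13LiveOfRecord F 2) p k) := by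
  intro h
  obtain ⟨g₀, hg₀⟩ := su2_dist1_surj 2 zero_le_two le_rfl
  have hd : (F.P p.K).d = 4 := rfl
  have hβlt : 2 * β < 2 := by
    rw [hd] at hβ3
    norm_num at hβ3
    linarith
  exact not_tLaw₁₃_zero_theta13LiveOfRecord F 2 p hK hS ha has hβ hβ3 hβ2 hβε ⟨g₀, by rw [hg₀]; exact ha2, by rw [hg₀]; exact hβlt⟩
    (h 0 hK (sLaw₁₃_zero F 2 _ p))

end AtRecord


end Summit.QuantumFields.YangMills.Theorems.BalabanUVNodesN11NoTLawAtAnyRegularity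

end
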